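/-
Copyright (c) 2026 the pub-hodgecm-mathlib formalisation cell (harness21).  Prover seat hodgecm-mathlib-K2E2-p12 (g10), Track B «K2-LIT», h413 = `stmt-HodgeConjecture-24833`,
route `HCCMUnconditional`; R90-TF section S8 «ContSpec-n½», ESTATE T PORTS (S8 dealer R90-CS-plan (g3), S8-R211 (2)), FILE 2 of 2: the CM heads of FILE 1 `K2E1ChiGaugeSymbolTauU3`
(`τ`-twins of ★ 7b-1's heads) in ★ `exists_chi_convData_cm_three`'s `hfam`∕`hnc` currency at a BARE `V`, the structural read-backs for pair-section spaces, and the one-dimensional sanity twin.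
-/
import Summits.HodgeConjecture.HodgeConjecture.Theorems.K2E1ChiGaugeSymbolTauU3          -- FILE 1 (this seat): `exists_gauge_symbol_of_scalars_three` (core), `exists_entire_symbol_of_scalars`, `symbol_eq_integral_arch_of_rightInvariant`; brings ★ 7b-1, ★ 12d-C
import Summits.HodgeConjecture.HodgeConjecture.Theorems.K2E1ChiSectionSpaceU3PairDefs    -- ★ `chiSectionSpacePair`, `IsChiSectionPair.borel_mul`
import Literature.NumberTheory.Automorphic.UnitaryGroupIwasawaAdelic                      -- ★ `exists_mem_borelAdelic_mul_mem_standardMaximalCompactGL[_cm]`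
import HarnessLib

/-!
# h413 ∕ R90-S8 ESTATE T — `K2E1ChiGaugeSymbolTauCMThree` (FILE 2): convData_χ's `hfam`∕`hnc` AT A BARE SECTION SPACE `V` FROM THE PER-`z` SCALAR LETTER (CM, `N = 3`), THE
# STRUCTURAL READ-BACKS FOR PAIR-SECTIONS, AND THE ONE-DIMENSIONAL SANITY TWIN

Cell `pub/hodgecm-mathlib`, crux H413 = `stmt-HodgeConjecture-24833`, route `HCCMUnconditional`; R90-TF section S8 «ContSpec-n½», ESTATE T (S8-R199 J-S8-ADM′, S8-R208 J-S8-T2,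
S8-R211 (2)).  THEOREMS ONLY (no `def`, no `instance`, no notation, no named-fact hypothesis, no `sorry`; default heartbeats); lane `--supports stmt-HodgeConjecture-24833 --as helper`
(count-neutral).  Closes no socket.

THE MATHEMATICS ([Bump1997] proof of Lemma 2.3.2; [BernsteinLapid2019] §4 Claim 1; [MoeglinWaldspurger1995] I.2.17; K2E1-p11 (g5)'s ESTATE T census cc10c33dbec127a5 (1)–(3)).  FILE 1's core
`exists_gauge_symbol_of_scalars_three` turns the per-`z` scalar letter `h12dCτ` («every `K_∞`-central pure tensor `h_∞ ⊗ 𝟙_{U₀∩G_f}` in `C_c` acts on `V ⊗ H^z` by per-`z` scalars»; ★ 12d-C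
at `V(χ, K′, ω)`, K2E1-p15's 12d-C_τ at a pure-`K_∞`-type block) into a gauge test function with an ENTIRE, NON-VANISHING-at-`z₀`, NON-CONSTANT symbol on `V`.  Here:
* §4 HEADS (CM) **`hfam_gauge_of_scalars_cm_three`**, **`hnc_gauge_of_scalars_cm_three`** — conclusions = ★ `K2E1ChiConvDataCMThree.exists_chi_convData_cm_three`'s `hfam`∕`hnc` binder types
  BYTE FOR BYTE at the bare `V`, so the K-finite exports' `hCD` is `exists_chi_convData_cm_three … V (hfam_gauge_of_scalars_cm_three …) (hnc_gauge_of_scalars_cm_three …) n`.  Binders: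
  `U₀ ≤ GL₃(𝒪̂_L)` open compact, `hVc` (continuous), `hVU` (right-`ι_f(U₀ ∩ G_f)`-invariant), `hVK` («vanishing on `K` ⇒ `0`»), THE LETTER `h12dCτ` (`hten`∕`hcent` in ★ 12d-C's bytes).
* §5 READ-BACKS: **`forall_apply_mul_finAdelicToAdelic_of_le_chiSectionSpacePair`** (`hVU` for `V ≤ V(χ₁, χ₂; K′, ω′)` from the usual level binder `hU`),
  **`eq_zero_of_forall_K_eq_zero_of_isChiSectionPair[_cm]`**, **`hVK_of_le_chiSectionSpacePair_cm`** (`hVK` for pair-sections: Iwasawa `G(𝔸) = B(𝔸)K` + the left Borel law), and the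
  SANITY TWIN **`scalars_of_chiSectionSpace`**: at `V := chiSectionSpace χ K′ ω` the letter `h12dCτ` IS ★ 12d-C `exists_integral_pureTensor_mul_flatSectionU_eq` (every `N`) — so ★ 7b-1 = FILE 1 §3
  ∘ ★ 12d-C, and the τ-consumer pays the same letter by 12d-C_τ.
HONEST LABEL: HC_CM is proved only modulo the 7 printed citations (2 remaining named inputs: hLiu418 = `stmt-HodgeConjecture-24832`, h413 = `stmt-HodgeConjecture-24833`) until rung 0
closes; this file asserts no named fact and closes no socket; the letter `h12dCτ` at a pure-type block (K2E1-p15) is NOT proved here; count-neutral.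

## References
* [Bump1997] D. Bump, *Automorphic Forms and Representations* (1997), proof of Lemma 2.3.2.
* [BernsteinLapid2019] J. Bernstein, E. Lapid, *On the meromorphic continuation of Eisenstein series*, J. Amer. Math. Soc. 37 (2024) (arXiv:1911.02342), §4 Claim 1.
* [Langlands1976] R. P. Langlands, *On the Functional Equations Satisfied by Eisenstein Series*, LNM 544 (1976), §6.
* [MoeglinWaldspurger1995] C. Mœglin, J.-L. Waldspurger, *Spectral Decomposition and Eisenstein Series* (1995), I.2.17.
* [BorelJacquet1979] A. Borel, H. Jacquet, *Automorphic forms and automorphic representations*, Proc. Symp. Pure Math. 33.1 (1979), §4.1.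
* [Rogawski1990] J. D. Rogawski, *Automorphic Representations of Unitary Groups in Three Variables* (1990), §13.9.
-/

set_option autoImplicit false
set_option linter.dupNamespace false  -- the mandated namespace repeats the summit's segment

noncomputable section

open MeasureTheory Measure NumberField NumberField.mixedEmbedding IsDedekindDomain Set Filter Topology
open scoped NNReal MatrixGroups Classical Pointwise
open Literature.NumberTheory Literature.NumberTheory.Automorphic Literature.NumberTheory.Automorphic.UnitaryGroup AdelicGroupData
open Literature.NumberTheory.Automorphic.Arthur2013.Leaves.TECR
open Literature.NumberTheory.GaloisRepresentations (HeckeCharacter)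
open Summit.HodgeConjecture.HodgeConjecture.Cruxes.H413.K2E1BorelEisensteinU
open Summit.HodgeConjecture.HodgeConjecture.Cruxes.H413.K2E1CharacterEisensteinU2Defs
open Summit.HodgeConjecture.HodgeConjecture.Cruxes.H413.K2E1ChiSectionSpaceU2Defs
open Summit.HodgeConjecture.HodgeConjecture.Cruxes.H413.K2E1CharacterEisensteinU3PairDefs
open Summit.HodgeConjecture.HodgeConjecture.Cruxes.H413.K2E1ChiSectionSpaceU3PairDefs
open Summit.HodgeConjecture.HodgeConjecture.Cruxes.H413.K2E1ArchPureTensorSelfConvolutionU2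
open Summit.HodgeConjecture.HodgeConjecture.Cruxes.H413.K2E1ChiHeckeArchScalarU2 (exists_integral_pureTensor_mul_flatSectionU_eq)
open Summit.HodgeConjecture.HodgeConjecture.Cruxes.H413.K2E1ChiGaugeSymbolTauU3 (exists_gauge_symbol_of_scalars_three)

namespace Summit.HodgeConjecture.HodgeConjecture.Cruxes.H413.K2E1ChiGaugeSymbolTauCMThree

/-! ## §4 HEADS (CM, `N = 3`): convData_χ's `hfam`∕`hnc` at a bare `V`, from the per-`z` scalar letter -/

section Heads

variable (L : Type) [Field L] [NumberField L] [IsCMField L]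
variable [MeasurableSpace (quasiSplit (↥(maximalRealSubfield L)) L (IsCMField.complexConj L) 3).Adelic] [BorelSpace (quasiSplit (↥(maximalRealSubfield L)) L (IsCMField.complexConj L) 3).Adelic]
variable [MeasurableSpace (arch (↥(maximalRealSubfield L)) L (IsCMField.complexConj L) 3 ((StdForm.antidiagonal 3).over L))] [BorelSpace (arch (↥(maximalRealSubfield L)) L (IsCMField.complexConj L) 3 ((StdForm.antidiagonal 3).over L))]
variable [MeasurableSpace (finAdelic (↥(maximalRealSubfield L)) L (IsCMField.complexConj L) 3 ((StdForm.antidiagonal 3).over L))] [BorelSpace (finAdelic (↥(maximalRealSubfield L)) L (IsCMField.complexConj L) 3 ((StdForm.antidiagonal 3).over L))]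
variable (νG : Measure (quasiSplit (↥(maximalRealSubfield L)) L (IsCMField.complexConj L) 3).Adelic) [νG.IsHaarMeasure]
variable (μa : Measure (arch (↥(maximalRealSubfield L)) L (IsCMField.complexConj L) 3 ((StdForm.antidiagonal 3).over L))) [μa.IsHaarMeasure] [μa.IsMulRightInvariant]
variable (μf : Measure (finAdelic (↥(maximalRealSubfield L)) L (IsCMField.complexConj L) 3 ((StdForm.antidiagonal 3).over L))) [μf.IsHaarMeasure]

include μa μf in
/-- **HEAD `hfam` AT A BARE `V`, FROM THE PER-`z` SCALAR LETTER** — the letter `hfam` of ★ `K2E1ChiConvDataCMThree.exists_chi_convData_cm_three` at `V` (bytes of its binder, `V` bare): for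
every `z₀` a symmetric non-negative `GL₃(𝔸_L)` test function `η = α_ψ ⊗ 𝟙_{U₀}` and an ENTIRE `s` with `s z₀ ≠ 0` such that `S_η̃ η̃` acts on every `f_z^φ`, `φ ∈ V`, by `s(z)`.
Binders: `U₀ ≤ GL₃(𝒪̂_L)` open compact; `V` continuous (`hVc`), right-`ι_f(U₀ ∩ G_f)`-invariant (`hVU`), «vanishing on `K` ⇒ `0`» (`hVK`, §5 for pair-sections); THE LETTER `h12dCτ` (§3);
a two-sided Haar measure `μ_∞` on `G_∞` and a Haar `μ_f` on `G(𝔸_f)` (proof only). [cite: Bump1997, proof of Lemma 2.3.2] [cite: BernsteinLapid2019, §4 Claim 1] -/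
theorem hfam_gauge_of_scalars_cm_three
    (U₀ : Subgroup (GL (Fin 3) (FiniteAdeleRing (𝓞 L) L))) (hU₀o : IsOpen (U₀ : Set (GL (Fin 3) (FiniteAdeleRing (𝓞 L) L)))) (hU₀c : IsCompact (U₀ : Set (GL (Fin 3) (FiniteAdeleRing (𝓞 L) L))))
    (hU₀K : U₀ ≤ glFiniteIntegralLevel 3 L)
    (V : Submodule ℂ ((quasiSplit (↥(maximalRealSubfield L)) L (IsCMField.complexConj L) 3).Adelic → ℂ)) (hVc : ∀ φ ∈ V, Continuous φ)
    (hVU : ∀ φ ∈ V, ∀ b : finAdelic (↥(maximalRealSubfield L)) L (IsCMField.complexConj L) 3 ((StdForm.antidiagonal 3).over L), (b : GL (Fin 3) (FiniteAdeleRing (𝓞 L) L)) ∈ U₀ →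
      ∀ y : (quasiSplit (↥(maximalRealSubfield L)) L (IsCMField.complexConj L) 3).Adelic, φ (y * finAdelicToAdelic (↥(maximalRealSubfield L)) L (IsCMField.complexConj L) 3 ((StdForm.antidiagonal 3).over L) b) = φ y)
    (hVK : ∀ φ ∈ V, (∀ k : (quasiSplit (↥(maximalRealSubfield L)) L (IsCMField.complexConj L) 3).Adelic,
      adelicVal (↥(maximalRealSubfield L)) L (IsCMField.complexConj L) 3 ((StdForm.antidiagonal 3).over L) k ∈ standardMaximalCompactGL 3 L → φ k = 0) → φ = 0)
    (h12dCτ : ∀ (h : (quasiSplit (↥(maximalRealSubfield L)) L (IsCMField.complexConj L) 3).Adelic → ℂ) (hinf : arch (↥(maximalRealSubfield L)) L (IsCMField.complexConj L) 3 ((StdForm.antidiagonal 3).over L) → ℂ),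
      Continuous h → HasCompactSupport h →
      (∀ y, h y = hinf (archPart (↥(maximalRealSubfield L)) L (IsCMField.complexConj L) 3 _ y) *
        ((U₀.subgroupOf (finAdelic (↥(maximalRealSubfield L)) L (IsCMField.complexConj L) 3 ((StdForm.antidiagonal 3).over L)) : Subgroup _) :
          Set (finAdelic (↥(maximalRealSubfield L)) L (IsCMField.complexConj L) 3 ((StdForm.antidiagonal 3).over L))).indicator (fun _ => (1 : ℂ)) (finPart (↥(maximalRealSubfield L)) L (IsCMField.complexConj L) 3 _ y)) →
      (∀ k ∈ (((standardMaximalCompactGL 3 L).comap (adelicVal (↥(maximalRealSubfield L)) L (IsCMField.complexConj L) 3 ((StdForm.antidiagonal 3).over L))).comap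
          (archToAdelic (↥(maximalRealSubfield L)) L (IsCMField.complexConj L) 3 ((StdForm.antidiagonal 3).over L))), ∀ y, hinf (k⁻¹ * y * k) = hinf y) →
      ∀ z : ℂ, ∃ s : ℂ, ∀ φ ∈ V, ∀ x : (quasiSplit (↥(maximalRealSubfield L)) L (IsCMField.complexConj L) 3).Adelic, ∫ y, h y * flatSectionU φ z (x * y) ∂νG = s * flatSectionU φ z x) :
    ∀ z₀ : ℂ, ∃ η : GL (Fin 3) (AdeleRing (𝓞 L) L) → ℝ, IsTestFunctionGL 3 L η ∧ (∀ g, 0 ≤ η g) ∧ (∀ g, η g⁻¹ = η g) ∧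
      ∃ s : ℂ → ℂ, Differentiable ℂ s ∧ s z₀ ≠ 0 ∧ ∀ z : ℂ, ∀ φ ∈ V, ∀ x : (quasiSplit (↥(maximalRealSubfield L)) L (IsCMField.complexConj L) 3).Adelic,
        (∫ y, (fun y : (quasiSplit (↥(maximalRealSubfield L)) L (IsCMField.complexConj L) 3).Adelic => orbitalSmoothing νG (fun x : (quasiSplit (↥(maximalRealSubfield L)) L (IsCMField.complexConj L) 3).Adelic => ((η (adelicVal (↥(maximalRealSubfield L)) L (IsCMField.complexConj L) 3 ((StdForm.antidiagonal 3).over L) x) : ℝ) : ℂ)) (fun x : (quasiSplit (↥(maximalRealSubfield L)) L (IsCMField.complexConj L) 3).Adelic => ((η (adelicVal (↥(maximalRealSubfield L)) L (IsCMField.complexConj L) 3 ((StdForm.antidiagonal 3).over L) x) : ℝ) : ℂ)) y) y *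
          flatSectionU φ z (x * y) ∂νG) = s z * flatSectionU φ z x := by
  intro z₀
  obtain ⟨ψ, s, hsd, hs0, -, hact⟩ := exists_gauge_symbol_of_scalars_three νG μa μf U₀ hU₀o hU₀c hU₀K hVc hVU hVK h12dCτ z₀
  exact ⟨fun g => adelicWeight U₀ (archBump ψ) g, isTestFunctionGL_gaugeWeight ψ U₀ hU₀o hU₀c, gaugeWeight_nonneg ψ U₀, gaugeWeight_inv ψ U₀, s, hsd, hs0, hact⟩

include μa μf in
/-- **HEAD `hnc` AT A BARE `V`, FROM THE PER-`z` SCALAR LETTER** — the letter `hnc` of ★ `exists_chi_convData_cm_three` at `V`: ONE such test function whose entire symbol is NON-CONSTANT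
(second difference along the `N = 3` archimedean ray).  Same binders as `hfam_gauge_of_scalars_cm_three`. [cite: Bump1997, proof of Lemma 2.3.2] [cite: Langlands1976, §6] -/
theorem hnc_gauge_of_scalars_cm_three
    (U₀ : Subgroup (GL (Fin 3) (FiniteAdeleRing (𝓞 L) L))) (hU₀o : IsOpen (U₀ : Set (GL (Fin 3) (FiniteAdeleRing (𝓞 L) L)))) (hU₀c : IsCompact (U₀ : Set (GL (Fin 3) (FiniteAdeleRing (𝓞 L) L))))
    (hU₀K : U₀ ≤ glFiniteIntegralLevel 3 L)
    (V : Submodule ℂ ((quasiSplit (↥(maximalRealSubfield L)) L (IsCMField.complexConj L) 3).Adelic → ℂ)) (hVc : ∀ φ ∈ V, Continuous φ)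
    (hVU : ∀ φ ∈ V, ∀ b : finAdelic (↥(maximalRealSubfield L)) L (IsCMField.complexConj L) 3 ((StdForm.antidiagonal 3).over L), (b : GL (Fin 3) (FiniteAdeleRing (𝓞 L) L)) ∈ U₀ →
      ∀ y : (quasiSplit (↥(maximalRealSubfield L)) L (IsCMField.complexConj L) 3).Adelic, φ (y * finAdelicToAdelic (↥(maximalRealSubfield L)) L (IsCMField.complexConj L) 3 ((StdForm.antidiagonal 3).over L) b) = φ y)
    (hVK : ∀ φ ∈ V, (∀ k : (quasiSplit (↥(maximalRealSubfield L)) L (IsCMField.complexConj L) 3).Adelic,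
      adelicVal (↥(maximalRealSubfield L)) L (IsCMField.complexConj L) 3 ((StdForm.antidiagonal 3).over L) k ∈ standardMaximalCompactGL 3 L → φ k = 0) → φ = 0)
    (h12dCτ : ∀ (h : (quasiSplit (↥(maximalRealSubfield L)) L (IsCMField.complexConj L) 3).Adelic → ℂ) (hinf : arch (↥(maximalRealSubfield L)) L (IsCMField.complexConj L) 3 ((StdForm.antidiagonal 3).over L) → ℂ),
      Continuous h → HasCompactSupport h →
      (∀ y, h y = hinf (archPart (↥(maximalRealSubfield L)) L (IsCMField.complexConj L) 3 _ y) *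
        ((U₀.subgroupOf (finAdelic (↥(maximalRealSubfield L)) L (IsCMField.complexConj L) 3 ((StdForm.antidiagonal 3).over L)) : Subgroup _) :
          Set (finAdelic (↥(maximalRealSubfield L)) L (IsCMField.complexConj L) 3 ((StdForm.antidiagonal 3).over L))).indicator (fun _ => (1 : ℂ)) (finPart (↥(maximalRealSubfield L)) L (IsCMField.complexConj L) 3 _ y)) →
      (∀ k ∈ (((standardMaximalCompactGL 3 L).comap (adelicVal (↥(maximalRealSubfield L)) L (IsCMField.complexConj L) 3 ((StdForm.antidiagonal 3).over L))).comap
          (archToAdelic (↥(maximalRealSubfield L)) L (IsCMField.complexConj L) 3 ((StdForm.antidiagonal 3).over L))), ∀ y, hinf (k⁻¹ * y * k) = hinf y) →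
      ∀ z : ℂ, ∃ s : ℂ, ∀ φ ∈ V, ∀ x : (quasiSplit (↥(maximalRealSubfield L)) L (IsCMField.complexConj L) 3).Adelic, ∫ y, h y * flatSectionU φ z (x * y) ∂νG = s * flatSectionU φ z x) :
    ∃ η : GL (Fin 3) (AdeleRing (𝓞 L) L) → ℝ, IsTestFunctionGL 3 L η ∧ (∀ g, 0 ≤ η g) ∧ (∀ g, η g⁻¹ = η g) ∧
      ∃ s : ℂ → ℂ, Differentiable ℂ s ∧ (∃ z₁ z₂ : ℂ, s z₁ ≠ s z₂) ∧ ∀ z : ℂ, ∀ φ ∈ V, ∀ x : (quasiSplit (↥(maximalRealSubfield L)) L (IsCMField.complexConj L) 3).Adelic,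
        (∫ y, (fun y : (quasiSplit (↥(maximalRealSubfield L)) L (IsCMField.complexConj L) 3).Adelic => orbitalSmoothing νG (fun x : (quasiSplit (↥(maximalRealSubfield L)) L (IsCMField.complexConj L) 3).Adelic => ((η (adelicVal (↥(maximalRealSubfield L)) L (IsCMField.complexConj L) 3 ((StdForm.antidiagonal 3).over L) x) : ℝ) : ℂ)) (fun x : (quasiSplit (↥(maximalRealSubfield L)) L (IsCMField.complexConj L) 3).Adelic => ((η (adelicVal (↥(maximalRealSubfield L)) L (IsCMField.complexConj L) 3 ((StdForm.antidiagonal 3).over L) x) : ℝ) : ℂ)) y) y *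
          flatSectionU φ z (x * y) ∂νG) = s z * flatSectionU φ z x := by
  obtain ⟨ψ, s, hsd, -, hnc, hact⟩ := exists_gauge_symbol_of_scalars_three νG μa μf U₀ hU₀o hU₀c hU₀K hVc hVU hVK h12dCτ 0
  exact ⟨fun g => adelicWeight U₀ (archBump ψ) g, isTestFunctionGL_gaugeWeight ψ U₀ hU₀o hU₀c, gaugeWeight_nonneg ψ U₀, gaugeWeight_inv ψ U₀, s, hsd, hnc, hact⟩

end Heads

/-! ## §5 READ-BACKS: the structural binders for pair-section spaces, and the one-dimensional sanity twin -/

section ReadBacks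

variable {F E : Type} [Field F] [NumberField F] [Field E] [NumberField E] [Algebra F E] {c : E ≃ₐ[F] E}

/-- **`hVU` FROM THE USUAL LEVEL BINDER `hU`**: if every `b_f ∈ U₀ ∩ G_f` has `ι_f(b) ∈ K′` with `ω′(ι_f b) = 1`, then every member of a subspace `V ≤ V(χ₁, χ₂; K′, ω′)` is right-invariant
under `ι_f(U₀ ∩ G_f)` (the right law of ★ `chiSectionSpacePair`). [cite: MoeglinWaldspurger1995, I.2.17] -/
theorem forall_apply_mul_finAdelicToAdelic_of_le_chiSectionSpacePair {χ₁ : HeckeCharacter E} {χ₂ : ↥(TorusDict.torus c) →ₜ* ℂˣ}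
    {K' : Subgroup (quasiSplit F E c 3).Adelic} {ω' : ↥K' → ℂ} (U₀ : Subgroup (GL (Fin 3) (FiniteAdeleRing (𝓞 E) E)))
    (hU : ∀ b : finAdelic F E c 3 ((StdForm.antidiagonal 3).over E), (b : GL (Fin 3) (FiniteAdeleRing (𝓞 E) E)) ∈ U₀ →
      ∃ hb : finAdelicToAdelic F E c 3 ((StdForm.antidiagonal 3).over E) b ∈ K', ω' ⟨_, hb⟩ = 1)
    {V : Submodule ℂ ((quasiSplit F E c 3).Adelic → ℂ)} (hV : V ≤ chiSectionSpacePair χ₁ χ₂ K' ω') :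
    ∀ φ ∈ V, ∀ b : finAdelic F E c 3 ((StdForm.antidiagonal 3).over E), (b : GL (Fin 3) (FiniteAdeleRing (𝓞 E) E)) ∈ U₀ →
      ∀ y : (quasiSplit F E c 3).Adelic, φ (y * finAdelicToAdelic F E c 3 ((StdForm.antidiagonal 3).over E) b) = φ y := by
  intro φ hφ b hb y
  obtain ⟨hbK, hωb⟩ := hU b hb
  have e := (hV hφ).2 y ⟨_, hbK⟩
  rw [hωb, one_mul] at e
  exact e

/-- **`hVK` FOR PAIR-SECTIONS (generic quadratic datum)**: under the adelic Iwasawa decomposition `G(𝔸) = B(𝔸)·K` (`c ≠ 1` fixing the infinite places, ★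
`exists_mem_borelAdelic_mul_mem_standardMaximalCompactGL`), a `(χ₁, χ₂)`-pair-section vanishing on `K` vanishes: `φ(b k) = χ₁(b₀₀)χ₂(b₁₁)·φ(k) = 0` (★ `IsChiSectionPair.borel_mul`).
[cite: MoeglinWaldspurger1995, I.2.17] [cite: BorelJacquet1979, §4.1] -/
theorem eq_zero_of_forall_K_eq_zero_of_isChiSectionPair [Algebra.IsQuadraticExtension F E] (hc : c ≠ 1) (hfix : ∀ w : InfinitePlace E, c • w = w)
    {χ₁ : HeckeCharacter E} {χ₂ : ↥(TorusDict.torus c) →ₜ* ℂˣ} {φ : (quasiSplit F E c 3).Adelic → ℂ} (hφ : IsChiSectionPair χ₁ χ₂ φ)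
    (h0 : ∀ k : (quasiSplit F E c 3).Adelic, adelicVal F E c 3 ((StdForm.antidiagonal 3).over E) k ∈ standardMaximalCompactGL 3 E → φ k = 0) : φ = 0 := by
  funext x
  obtain ⟨b, hb, k, hk, rfl⟩ := exists_mem_borelAdelic_mul_mem_standardMaximalCompactGL c hc hfix x
  rw [hφ.borel_mul hb, h0 k hk, mul_zero, Pi.zero_apply]

variable (L : Type) [Field L] [NumberField L] [IsCMField L]

/-- **`hVK` FOR PAIR-SECTIONS, CM PACKAGING** (hypothesis-free Iwasawa ★ `exists_mem_borelAdelic_mul_mem_standardMaximalCompactGL_cm`). [cite: MoeglinWaldspurger1995, I.2.17] [cite: Rogawski1990, §13.9] -/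
theorem eq_zero_of_forall_K_eq_zero_of_isChiSectionPair_cm {χ₁ : HeckeCharacter L} {χ₂ : ↥(TorusDict.torus (IsCMField.complexConj L)) →ₜ* ℂˣ}
    {φ : (quasiSplit (↥(maximalRealSubfield L)) L (IsCMField.complexConj L) 3).Adelic → ℂ} (hφ : IsChiSectionPair χ₁ χ₂ φ)
    (h0 : ∀ k : (quasiSplit (↥(maximalRealSubfield L)) L (IsCMField.complexConj L) 3).Adelic,
      adelicVal (↥(maximalRealSubfield L)) L (IsCMField.complexConj L) 3 ((StdForm.antidiagonal 3).over L) k ∈ standardMaximalCompactGL 3 L → φ k = 0) : φ = 0 := by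
  funext x
  obtain ⟨b, hb, k, hk, rfl⟩ := exists_mem_borelAdelic_mul_mem_standardMaximalCompactGL_cm L x
  rw [hφ.borel_mul hb, h0 k hk, mul_zero, Pi.zero_apply]

/-- **`hVK` FOR A SUBSPACE `V ≤ V(χ₁, χ₂; K′, ω′)`, CM PACKAGING** — the binder `hVK` of §3–§4 at every block of pair-sections (in particular at a pure-`K_∞`-type block inside
`V(χ₁, χ₂; tauLevel U₀, 1)`, ESTATE T). [cite: MoeglinWaldspurger1995, I.2.17] [cite: Rogawski1990, §13.9] -/
theorem hVK_of_le_chiSectionSpacePair_cm {χ₁ : HeckeCharacter L} {χ₂ : ↥(TorusDict.torus (IsCMField.complexConj L)) →ₜ* ℂˣ}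
    {K' : Subgroup (quasiSplit (↥(maximalRealSubfield L)) L (IsCMField.complexConj L) 3).Adelic} {ω' : ↥K' → ℂ}
    {V : Submodule ℂ ((quasiSplit (↥(maximalRealSubfield L)) L (IsCMField.complexConj L) 3).Adelic → ℂ)} (hV : V ≤ chiSectionSpacePair χ₁ χ₂ K' ω') :
    ∀ φ ∈ V, (∀ k : (quasiSplit (↥(maximalRealSubfield L)) L (IsCMField.complexConj L) 3).Adelic,
      adelicVal (↥(maximalRealSubfield L)) L (IsCMField.complexConj L) 3 ((StdForm.antidiagonal 3).over L) k ∈ standardMaximalCompactGL 3 L → φ k = 0) → φ = 0 :=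
  fun _ hφ h0 => eq_zero_of_forall_K_eq_zero_of_isChiSectionPair_cm L (hV hφ).1 h0

end ReadBacks

section Sanity

variable {F E : Type} [Field F] [NumberField F] [Field E] [NumberField E] [Algebra F E] {c : E ≃ₐ[F] E} {N : ℕ} [NeZero N]
variable [MeasurableSpace (quasiSplit F E c N).Adelic] [BorelSpace (quasiSplit F E c N).Adelic]
variable [MeasurableSpace (arch F E c N ((StdForm.antidiagonal N).over E))] [BorelSpace (arch F E c N ((StdForm.antidiagonal N).over E))]
variable [MeasurableSpace (finAdelic F E c N ((StdForm.antidiagonal N).over E))] [BorelSpace (finAdelic F E c N ((StdForm.antidiagonal N).over E))]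
variable (νG : Measure (quasiSplit F E c N).Adelic) [νG.IsHaarMeasure]
variable (μa : Measure (arch F E c N ((StdForm.antidiagonal N).over E))) [μa.IsHaarMeasure] [μa.IsMulRightInvariant]
variable (μf : Measure (finAdelic F E c N ((StdForm.antidiagonal N).over E))) [μf.IsHaarMeasure]

include μa μf in
/-- **THE ONE-DIMENSIONAL SANITY TWIN — AT `V := chiSectionSpace χ K′ ω` THE LETTER `h12dCτ` IS ★ 12d-C** (`exists_integral_pureTensor_mul_flatSectionU_eq`, every `N`): for `c ≠ 1` fixing the
infinite places, `K′ ≤ K` containing `ι(K_∞)`, and `ι_f(U₀ ∩ G_f) ⊆ K′` acting trivially, every pure tensor `h_∞ ⊗ 𝟙_{U₀∩G_f}` with `K_∞`-central `h_∞` acts on `V(χ, K′, ω) ⊗ H^z` by per-`z`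
scalars — so ★ 7b-1 `exists_gauge_symbol_three` is §3 ∘ ★ 12d-C, and the τ-consumer pays the same letter by K2E1-p15's 12d-C_τ. [cite: BernsteinLapid2019, §4 Claim 1] [cite: BorelJacquet1979, §4.1] -/
theorem scalars_of_chiSectionSpace (hc : c ≠ 1) (hfix : ∀ w : InfinitePlace E, c • w = w)
    {χ : HeckeCharacter E} {K' : Subgroup (quasiSplit F E c N).Adelic} {ω : ↥K' → ℂ}
    (hK' : K' ≤ ((standardMaximalCompactGL N E).comap (adelicVal F E c N ((StdForm.antidiagonal N).over E)) : Subgroup (quasiSplit F E c N).Adelic))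
    (hKinf : ∀ k : arch F E c N ((StdForm.antidiagonal N).over E),
      adelicVal F E c N ((StdForm.antidiagonal N).over E) (archToAdelic F E c N _ k) ∈ standardMaximalCompactGL N E → archToAdelic F E c N _ k ∈ K')
    (U₀ : Subgroup (GL (Fin N) (FiniteAdeleRing (𝓞 E) E)))
    (hU : ∀ b : finAdelic F E c N ((StdForm.antidiagonal N).over E), (b : GL (Fin N) (FiniteAdeleRing (𝓞 E) E)) ∈ U₀ →
      ∃ hb : finAdelicToAdelic F E c N ((StdForm.antidiagonal N).over E) b ∈ K', ω ⟨_, hb⟩ = 1) :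
    ∀ (h : (quasiSplit F E c N).Adelic → ℂ) (hinf : arch F E c N ((StdForm.antidiagonal N).over E) → ℂ), Continuous h → HasCompactSupport h →
      (∀ y, h y = hinf (archPart F E c N _ y) *
        ((U₀.subgroupOf (finAdelic F E c N ((StdForm.antidiagonal N).over E)) : Subgroup _) : Set (finAdelic F E c N ((StdForm.antidiagonal N).over E))).indicator (fun _ => (1 : ℂ)) (finPart F E c N _ y)) →
      (∀ k ∈ (((standardMaximalCompactGL N E).comap (adelicVal F E c N ((StdForm.antidiagonal N).over E))).comap (archToAdelic F E c N ((StdForm.antidiagonal N).over E))),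
        ∀ y, hinf (k⁻¹ * y * k) = hinf y) →
      ∀ z : ℂ, ∃ s : ℂ, ∀ φ ∈ chiSectionSpace χ K' ω, ∀ x : (quasiSplit F E c N).Adelic, ∫ y, h y * flatSectionU φ z (x * y) ∂νG = s * flatSectionU φ z x :=
  fun _ _ _ _ hten hcent z => exists_integral_pureTensor_mul_flatSectionU_eq νG μa μf hc hfix hK' hKinf hten hcent (fun b hb => hU b (Subgroup.mem_subgroupOf.1 hb)) z

end Sanity

end Summit.HodgeConjecture.HodgeConjecture.Cruxes.H413.K2E1ChiGaugeSymbolTauCMThree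

end
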